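import Summits.BirchSwinnertonDyer.BirchSwinnertonDyer.Theses.ByReductionTypeAtTwo
import Summits.BirchSwinnertonDyer.BirchSwinnertonDyer.Theorems.ByReductionTypeAtTwoRankOneAtTwoOffBigImageOddLocalCellGlue
import Summits.BirchSwinnertonDyer.BirchSwinnertonDyer.Theorems.ByReductionTypeAtTwoRankOneAtTwoOffBigImageOddLocalSiblingBridge
import Summits.BirchSwinnertonDyer.BirchSwinnertonDyer.Theorems.ByReductionTypeAtTwoRankOneAtTwoOffBigImageOddLocalShiftedSiblingBridge
import Summits.BirchSwinnertonDyer.BirchSwinnertonDyer.Theorems.ByReductionTypeAtTwoRankOneAtTwoOffBigImageOddLocalImageCellDefs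
import Summits.BirchSwinnertonDyer.BirchSwinnertonDyer.Theorems.ByReductionTypeAtTwoRankOneAtTwoBigImageOddLocalOneDoorValue
import Summits.BirchSwinnertonDyer.BirchSwinnertonDyer.Theorems.ByReductionTypeAtTwoRankOneAtTwoOffBigImageOddLocalDeepSiblingGlue
import HarnessLib

/-!
# Route `ByReductionTypeAtTwo`, crux `RankOneAtTwoOffBigImageOddLocal` (stmt-BirchSwinnertonDyer-23716), line
# `refined_kolyvagin_tamagawa_shift_at_two`: THE LINE'S ASSEMBLY as ONE importable conditional kernel theorem

Lead prover `prover-cruxlead-stmt-BirchSwinnertonDyer-23716-g5` (2026-08-28; `--supports stmt-BirchSwinnertonDyer-23716`).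

The registered skeleton `Cruxes/RankOneAtTwoOffBigImageOddLocal/Lines/refined_kolyvagin_tamagawa_shift_at_two.lean` (g12, sha
`6b2f6e4e79c1…`, seven `stub_*`) proves the crux BY NAME from its seven stub statements (`RankOneAtTwoOffBigImageOddLocal_of_hyps`,
seventh kernel-checked path `comp_g7_byName`), but that composition lives in a `Cruxes/` workfile, which `Theorems/` and the route cannot
import.  This module states the SAME composition over IMPORTABLE names only, so that the route consumes the line as one theorem (the
pattern of `…KatoFreeSandwichAssembly.lean` on 19577 and `ordKatoHalfAtTwoIso_of_memo_cite` on 19573):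

`rankOneAtTwoOffBigImageOddLocal_of_line : S_print → GoodOrdinaryRankZeroAtTwo → MultiplicativeRankZeroAtTwo → SupersingularRankZeroAtTwo →
  AdditiveRankZeroAtTwo → KolyvaginExactAtTwo → KolyvaginExactAtTwoShifted → Gamma1DoorIndexLawCTAtTwo → SigmaAccumulationModTwoAtTwo →
  StringentPrimitivityModTwoAtTwo → ShiftedKolyvaginStructureModTwoWithOnPos ⊤ OnDeltaPlusCell →
  ShiftedKolyvaginStructureModTwoWithOn ⊤ OffFullImageCell → TwoTorsionHalf → RankOneAtTwoOffBigImageOddLocal`.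

The thirteen hypotheses are, by name: PRINT `S_print` (`S_pub` ∧ `S_pubHL` ∧ Milne 1972 any-model — Literature named facts, unproved in the
tree: the theorem is CONDITIONAL on them); the route's four rank-`0` cruxes at `2` (items 19095–19098 by name, OPEN); route
`GenusKolyvaginAtTwo`'s K-side cruxes 22137 `KolyvaginExactAtTwo` and 27469 `KolyvaginExactAtTwoShifted` (OPEN); and the line's five content
statements (`Theorems/…OffBigImageOddLocalDefs.lean`, `…ImageCellDefs.lean`): the merged γ₁ door law, K1 Σ-accumulation, K2 stringent
primitivity (Kolyvagin's conjecture at `2` at level `σ + 1`), K3 on the `Δ > 0` full-image cell at `σ ≥ 1`, K3 on the γ₂ cell, and the β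
residual `TwoTorsionHalf` — every one of them OPEN mathematics at `p = 2` (registered stubs of the skeleton; 0 of 7 closed).  Glue used (all
landed): `bsdp_two_gamma1` (γ₁, `…Glue`), `bsdp_two_S3locus_of_atlas` / `stringentWithOn_top_of_modTwo` (`…CellGlue`), the sibling bridges
`shiftedStructure_of_kolyvaginExactAtTwo_of_sigmaShift_eq_zero` (p660076) and `shiftedStructure_of_kolyvaginExactAtTwoShifted` (p663057),
`bsdp_two_of_rankZero_cruxes` (`…OneDoorValue`), `isSquare_delta_of_not_hasSurjectiveModNGaloisRep_two` (`…Glue`).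

Also recorded (`bsdp_two_rankOne_of_line`, `rankOneAtTwo_of_line`): the crux's «off the slice» binder is IDLE in this composition — the same
thirteen statements give `BSD(W, 2)` for EVERY non-CM `W` of analytic rank `1`, i.e. the PARENT `RankOneAtTwo` (the slice {full `2`-adic image ∧
odd torsion ∧ odd `∏c`} lies in the full-image cell, served by 22137/27469/the `Δ > 0` statement like the rest of δ).

BSD is NOT proved by this file; the crux is NOT proved (every content hypothesis is open); the summit is NOT proved.  No `sorry`, no new
definition, axioms ⊆ {propext, Classical.choice, Quot.sound}.

References (locators, plain text): Gross, LMS LNS 153 (1991) §§3–5; McCallum, ibid. §5 Thm. 5.4; W. Zhang, Camb. J. Math. 2 (2014) §3.7;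
Jetchev, Compositio 144 (2008) Thm. 1.4; Burungale–Castella–Grossi–Skinner arXiv:2312.09301 Thm. 2; Milne, Invent. Math. 17 (1972) §1 Thm. 1.
-/

set_option linter.dupNamespace false -- tree convention: `Summit.BirchSwinnertonDyer.BirchSwinnertonDyer.Theorems` (summit = sub-problem)
set_option autoImplicit false

noncomputable section

open scoped Classical

namespace Summit.BirchSwinnertonDyer.BirchSwinnertonDyer.Theorems.OffBigImageOddLocalAtTwo

open WeierstrassCurve NumberField Literature.NumberTheory.EllipticCurves
  Literature.NumberTheory.EllipticCurves.ModularForms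
  Summit.BirchSwinnertonDyer.Rank1Residual.F1Sign2
  Summit.BirchSwinnertonDyer.Rank1Residual.F1Sign2.TranspositionDoor
  Summit.BirchSwinnertonDyer.BirchSwinnertonDyer.Theses.ByReductionTypeAtTwo
  Summit.BirchSwinnertonDyer.BirchSwinnertonDyer.Theorems.RankOneAtTwoOneDoor
open Summit.BirchSwinnertonDyer.BirchSwinnertonDyer.Theses.GenusKolyvaginAtTwo

/-! ### §1 The image-cell atlas glue over importable names (skeleton §3⁶, re-proved here) -/

/-- The image-cell atlas {full `2`-adic image, its complement} covers every curve (excluded middle). -/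
theorem onFullImageCell_or_offFullImageCell (W : WeierstrassCurve ℚ) : OnFullImageCell W ∨ OffFullImageCell W :=
  Classical.em _

/-- **S₃-locus glue through the IMAGE-CELL atlas**: K1, the pair (K2, K3) with filter `Φδ` on the full-image cell δ and with filter `Φγ` on its
complement γ₂, PRINT and rank-`0` `BSD₂` of the twin ⟹ `BSD₂(W)` for every non-CM `W` with `ρ̄_{W,2}` onto of analytic rank `1` — the instance
of the landed `bsdp_two_S3locus_of_atlas` at the two-element index type (the skeleton's `bsdp_two_S3locus_imageCells`, now importable). -/
theorem bsdp_two_S3locus_imageCellAtlas (Φδ Φγ : WeierstrassCurve ℚ → ℕ → Prop)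
    (hpub : S_pub) (hHL : S_pubHL) (hMilneC : Milne1972.bsdQuotient_baseChange_quadratic_anyModel)
    (hK1 : SigmaAccumulationModTwoAtTwo)
    (hK2δ : StringentPrimitivityModTwoWithOn Φδ OnFullImageCell) (hK3δ : ShiftedKolyvaginStructureModTwoWithOn Φδ OnFullImageCell)
    (hK2γ : StringentPrimitivityModTwoWithOn Φγ OffFullImageCell) (hK3γ : ShiftedKolyvaginStructureModTwoWithOn Φγ OffFullImageCell)
    (hZ : S_rankZeroTwin)
    (W : WeierstrassCurve ℚ) [W.IsElliptic] [W.IsGloballyMinimal] (hCM : ¬ W.HasCM)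
    (hρ2 : W.HasSurjectiveModNGaloisRep 2) (hr : W.analyticRank = 1) : BSDp W 2 :=
  bsdp_two_S3locus_of_atlas (fun b : Bool => if b then Φδ else Φγ) (fun b => if b then OnFullImageCell else OffFullImageCell)
    hpub hHL hMilneC hK1 (fun b => by cases b <;> assumption) (fun b => by cases b <;> assumption) hZ
    (fun V _ _ _ _ _ => (onFullImageCell_or_offFullImageCell V).elim (fun h => ⟨true, h⟩) (fun h => ⟨false, h⟩)) W hCM hρ2 hr

/-! ### §2 K3 on the whole full-image cell from the sibling's cruxes BY NAME + the `Δ > 0`, `σ ≥ 1` statement (skeleton §3⁷, re-proved here) -/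

/-- **The re-line's glue on the full-image cell**: K3 with filter `Φ` on the WHOLE full-image cell δ from — 22137 `KolyvaginExactAtTwo` (the data
with `σ(W, Dt) = 0`, either sign of `Δ`; bridge `shiftedStructure_of_kolyvaginExactAtTwo_of_sigmaShift_eq_zero`), 27469
`KolyvaginExactAtTwoShifted` (every datum on `Δ < 0`; bridge `shiftedStructure_of_kolyvaginExactAtTwoShifted`), and the `σ ≥ 1` statement on the
`Δ > 0` full-image cell `OnDeltaPlusCell`.  Cover: `by_cases σ = 0`, then the sign of `Δ` (`Δ ≠ 0`, `W.isUnit_Δ`).  The witness filter `Φ` is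
dropped in the two by-name branches (they hold for numerical primes). -/
theorem structureWithOn_onFullImageCell_of_siblings_of_pos (Φ : WeierstrassCurve ℚ → ℕ → Prop)
    (h0 : KolyvaginExactAtTwo) (hS : KolyvaginExactAtTwoShifted)
    (hpos : ShiftedKolyvaginStructureModTwoWithOnPos Φ OnDeltaPlusCell) :
    ShiftedKolyvaginStructureModTwoWithOn Φ OnFullImageCell := by
  intro W _ _ _ hCM hρ hW K _ _ hK hodd h3 hH hsq1 hsq2 Dt β ι d₁ hy M₀ hdiv hndiv hacc n d hn hKoly hlev hPn
  have hfull : ∀ m : ℕ, W.HasSurjectiveModNGaloisRep ((2 ^ m : ℕ) : ℤ) := fun m => hW m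
  by_cases hσ : sigmaShift W Dt = 0
  · exact shiftedStructure_of_kolyvaginExactAtTwo_of_sigmaShift_eq_zero h0 W hCM hfull K hK hodd h3 hH hsq1 hsq2 Dt β ι d₁ hy hσ
      M₀ hdiv hndiv n d hn (fun ℓ hℓ => (hKoly ℓ hℓ).1) hPn
  rcases lt_or_gt_of_ne (W.isUnit_Δ.ne_zero) with hneg | hposΔ
  · exact shiftedStructure_of_kolyvaginExactAtTwoShifted hS W hCM hneg hfull K hK hodd h3 hH hsq1 hsq2 Dt β ι d₁ hy M₀ hdiv hndiv
      hacc n d hn (fun ℓ hℓ => (hKoly ℓ hℓ).1) hlev hPn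
  · exact hpos W hCM hρ ⟨hposΔ, fun n => hfull n⟩ K hK hodd h3 hH hsq1 hsq2 Dt β ι d₁ hy (Nat.pos_of_ne_zero hσ) M₀ hdiv hndiv
      hacc n d hn hKoly hlev hPn

/-! ### §3 The structural split by the mod-`2` image and the assembly -/

/-- **The structural split, cut by the MOD-`2` image** (skeleton `offBigImage_of_strataModTwo`, conclusion kept PER CURVE so that only the two
assembly theorems below conclude a route item by name): `by_cases` on `NoRationalTwoTorsion W` (β otherwise), then on `ρ̄_{W,2}` onto (the
S₃-locus); the negative branch is γ₁ (`Δ ∈ ℚ^{×2}`) by `isSquare_delta_of_not_hasSurjectiveModNGaloisRep_two`. -/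
theorem bsdp_two_rankOne_of_strataModTwo
    (hγ₁ : ∀ (W : WeierstrassCurve ℚ) [W.IsElliptic] [W.IsGloballyMinimal], ¬ W.HasCM →
      NoRationalTwoTorsion W → IsSquare W.Δ → W.analyticRank = 1 → BSDp W 2)
    (hS₃ : ∀ (W : WeierstrassCurve ℚ) [W.IsElliptic] [W.IsGloballyMinimal], ¬ W.HasCM →
      W.HasSurjectiveModNGaloisRep 2 → W.analyticRank = 1 → BSDp W 2)
    (hβ : TwoTorsionHalf)
    (W : WeierstrassCurve ℚ) [W.IsElliptic] [W.IsGloballyMinimal] (hCM : ¬ W.HasCM) (hr : W.analyticRank = 1) : BSDp W 2 := by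
  by_cases h2 : NoRationalTwoTorsion W
  · by_cases hs : W.HasSurjectiveModNGaloisRep 2
    · exact hS₃ W hCM hs hr
    · exact hγ₁ W hCM h2 (isSquare_delta_of_not_hasSurjectiveModNGaloisRep_two W h2 hs) hr
  · exact hβ W hCM h2 hr

/-- **THE LINE, PER CURVE**: PRINT, the route's four rank-`0` cruxes, the sibling's 22137 and 27469, the merged γ₁ door law, K1, K2 (numerical primes),
K3 on {full image, `Δ > 0`} at `σ ≥ 1`, K3 on γ₂, the β residual ⟹ `BSD(W, 2)` for EVERY non-CM globally minimal `W` of analytic rank `1`.  γ₁ by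
`bsdp_two_gamma1`; the S₃-locus by the image-cell atlas at `Φδ = Φγ = ⊤` with the δ pair (K2 restricted, K3 assembled by
`structureWithOn_onFullImageCell_of_siblings_of_pos`) and the γ₂ pair (K2 restricted, the γ₂ statement); the twin's rank-`0` `BSD₂` from the four
cruxes (`bsdp_two_of_rankZero_cruxes`).  BSD is not proved by this (thirteen open / unproved hypotheses). -/
theorem bsdp_two_rankOne_of_line (hprint : S_print)
    (hO : GoodOrdinaryRankZeroAtTwo) (hM : MultiplicativeRankZeroAtTwo) (hSS : SupersingularRankZeroAtTwo) (hA : AdditiveRankZeroAtTwo)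
    (h0 : KolyvaginExactAtTwo) (hS : KolyvaginExactAtTwoShifted)
    (hG : Gamma1DoorIndexLawCTAtTwo) (hK1 : SigmaAccumulationModTwoAtTwo) (hK2 : StringentPrimitivityModTwoAtTwo)
    (hK3p : ShiftedKolyvaginStructureModTwoWithOnPos (fun _ _ => True) OnDeltaPlusCell)
    (hK3γ : ShiftedKolyvaginStructureModTwoWithOn (fun _ _ => True) OffFullImageCell)
    (hβ : TwoTorsionHalf)
    (W : WeierstrassCurve ℚ) [W.IsElliptic] [W.IsGloballyMinimal] (hCM : ¬ W.HasCM) (hr : W.analyticRank = 1) : BSDp W 2 := by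
  obtain ⟨hpub, hHL, hMilneC⟩ := hprint
  have hZ : S_rankZeroTwin := fun V _ _ hVCM hV0 => bsdp_two_of_rankZero_cruxes ⟨hO, hM, hSS, hA⟩ V hVCM hV0
  exact bsdp_two_rankOne_of_strataModTwo
    (fun V _ _ hVCM hT2 hΔ hVr => bsdp_two_gamma1 hpub hHL hG hZ V hVCM hT2 hΔ hVr)
    (fun V _ _ hVCM hρ2 hVr => bsdp_two_S3locus_imageCellAtlas (fun _ _ => True) (fun _ _ => True) hpub hHL hMilneC hK1
      (stringentWithOn_top_of_modTwo _ hK2) (structureWithOn_onFullImageCell_of_siblings_of_pos _ h0 hS hK3p)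
      (stringentWithOn_top_of_modTwo _ hK2) hK3γ hZ V hVCM hρ2 hVr)
    hβ W hCM hr

/-- **THE LINE'S ASSEMBLY — the crux `RankOneAtTwoOffBigImageOddLocal` BY NAME from thirteen named statements** (PRINT; the route's four rank-`0`
cruxes 19095–19098; route `GenusKolyvaginAtTwo`'s 22137, 27469; the five content statements of line `refined_kolyvagin_tamagawa_shift_at_two` and
its β residual — the seven registered stubs of the skeleton unbundled into importable names).  CONDITIONAL: closes nothing by itself; each
hypothesis is an open item / unproved named fact.  BSD is NOT proved by this; the crux is NOT proved by this. -/
theorem rankOneAtTwoOffBigImageOddLocal_of_line : S_print →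
    GoodOrdinaryRankZeroAtTwo → MultiplicativeRankZeroAtTwo → SupersingularRankZeroAtTwo → AdditiveRankZeroAtTwo →
    KolyvaginExactAtTwo → KolyvaginExactAtTwoShifted →
    Gamma1DoorIndexLawCTAtTwo → SigmaAccumulationModTwoAtTwo → StringentPrimitivityModTwoAtTwo →
    ShiftedKolyvaginStructureModTwoWithOnPos (fun _ _ => True) OnDeltaPlusCell →
    ShiftedKolyvaginStructureModTwoWithOn (fun _ _ => True) OffFullImageCell → TwoTorsionHalf →
    RankOneAtTwoOffBigImageOddLocal :=
  fun hprint hO hM hSS hA h0 hS hG hK1 hK2 hK3p hK3γ hβ W _ _ hCM _hoff hr =>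
    bsdp_two_rankOne_of_line hprint hO hM hSS hA h0 hS hG hK1 hK2 hK3p hK3γ hβ W hCM hr

/-- **The «off the slice» binder is IDLE**: the same thirteen statements give the PARENT `RankOneAtTwo` (`BSD(W, 2)` for every non-CM `W` of
analytic rank `1`), because the slice {full `2`-adic image ∧ odd torsion ∧ odd `∏c`} lies in the full-image cell δ, which the composition serves
like the rest of δ (22137 at `σ = 0`, 27469 on `Δ < 0`, the `σ ≥ 1` statement on `Δ > 0`).  So line 1's stub set, if ever proved, also closes the
sibling crux 23715 — recorded for the planner; CONDITIONAL, closes nothing.  BSD is NOT proved by this. -/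
theorem rankOneAtTwo_of_line : S_print →
    GoodOrdinaryRankZeroAtTwo → MultiplicativeRankZeroAtTwo → SupersingularRankZeroAtTwo → AdditiveRankZeroAtTwo →
    KolyvaginExactAtTwo → KolyvaginExactAtTwoShifted →
    Gamma1DoorIndexLawCTAtTwo → SigmaAccumulationModTwoAtTwo → StringentPrimitivityModTwoAtTwo →
    ShiftedKolyvaginStructureModTwoWithOnPos (fun _ _ => True) OnDeltaPlusCell →
    ShiftedKolyvaginStructureModTwoWithOn (fun _ _ => True) OffFullImageCell → TwoTorsionHalf →
    RankOneAtTwo :=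
  fun hprint hO hM hSS hA h0 hS hG hK1 hK2 hK3p hK3γ hβ W _ _ hCM hr =>
    bsdp_two_rankOne_of_line hprint hO hM hSS hA h0 hS hG hK1 hK2 hK3p hK3γ hβ W hCM hr


/-! ### §5 (g6 append, 2026-08-28) The line in the DEEP witness currency of the pen's re-cut RC-343 (skeleton g13)
Statements `…OffBigImageOddLocalDeepDefs.lean` (p674589), glue `…OffBigImageOddLocalDeepGlue.lean` (p675023) and `…OffBigImageOddLocalDeepSiblingGlue.lean`
(p675344).  The K-side inputs become: K2(∞) = `StringentPrimitivityModTwoDeepWith RegularOnFullImageAtTwo` (Kolyvagin's conjecture at `2` in infinite supply on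
primes regular over the full-image cell), deep K3⁺ on {full image, `Δ > 0`} at `σ ≥ 1` and deep K3 on γ₂ (the stringent-primitivity witness ALSO at level
`≥ M₀ + 1`).  Everything above is unchanged (append protocol). -/

/-- **THE LINE, PER CURVE, deep currency (g13)**: PRINT, the route's four rank-`0` cruxes, the sibling's 22137 and 27469, the merged γ₁ door law, K1, K2(∞) on
primes regular over δ, deep K3⁺ on {full image, `Δ > 0`} at `σ ≥ 1` with the same filter, deep K3 on γ₂ with numerical primes, the β residual ⟹ `BSD(W, 2)`
for EVERY non-CM globally minimal `W` of analytic rank `1`.  γ₁ by `bsdp_two_gamma1`; the S₃-locus by `bsdp_two_S3locusDeep_imageCells` (filters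
`RegularOnFullImageAtTwo ≤ ⊤`) with the δ statement assembled by `structureDeepWithOn_fullImage_of_names_of_posDeep`.  BSD is not proved by this
(thirteen open / unproved hypotheses). [cite: McCallumLMS1991, §5 Thm. 5.4] -/
theorem bsdp_two_rankOne_of_line_deep (hprint : S_print)
    (hO : GoodOrdinaryRankZeroAtTwo) (hM : MultiplicativeRankZeroAtTwo) (hSS : SupersingularRankZeroAtTwo) (hA : AdditiveRankZeroAtTwo)
    (h0 : KolyvaginExactAtTwo) (hS : KolyvaginExactAtTwoShifted)
    (hG : Gamma1DoorIndexLawCTAtTwo) (hK1 : SigmaAccumulationModTwoAtTwo)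
    (hK2 : StringentPrimitivityModTwoDeepWith RegularOnFullImageAtTwo)
    (hK3p : ShiftedKolyvaginStructureModTwoDeepWithOnPos RegularOnFullImageAtTwo OnDeltaPlusCell)
    (hK3γ : ShiftedKolyvaginStructureModTwoDeepWithOn (fun _ _ => True) OffFullImageCell)
    (hβ : TwoTorsionHalf)
    (W : WeierstrassCurve ℚ) [W.IsElliptic] [W.IsGloballyMinimal] (hCM : ¬ W.HasCM) (hr : W.analyticRank = 1) : BSDp W 2 := by
  obtain ⟨hpub, hHL, hMilneC⟩ := hprint
  have hZ : S_rankZeroTwin := fun V _ _ hVCM hV0 => bsdp_two_of_rankZero_cruxes ⟨hO, hM, hSS, hA⟩ V hVCM hV0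
  exact bsdp_two_rankOne_of_strataModTwo
    (fun V _ _ hVCM hT2 hΔ hVr => bsdp_two_gamma1 hpub hHL hG hZ V hVCM hT2 hΔ hVr)
    (fun V _ _ hVCM hρ2 hVr => bsdp_two_S3locusDeep_imageCells RegularOnFullImageAtTwo (fun _ _ => True) (fun _ _ _ => trivial)
      hpub hHL hMilneC hK1 hK2 (structureDeepWithOn_fullImage_of_names_of_posDeep _ h0 hS hK3p) hK3γ hZ V hVCM hρ2 hVr)
    hβ W hCM hr

/-- **THE LINE'S ASSEMBLY in the deep currency — the crux `RankOneAtTwoOffBigImageOddLocal` BY NAME from thirteen named statements** (the seven registered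
stubs of skeleton g13 unbundled into importable names).  CONDITIONAL: closes nothing by itself.  BSD is NOT proved by this; the crux is NOT proved by this.
[cite: McCallumLMS1991, §5 Thm. 5.4] -/
theorem rankOneAtTwoOffBigImageOddLocal_of_line_deep : S_print →
    GoodOrdinaryRankZeroAtTwo → MultiplicativeRankZeroAtTwo → SupersingularRankZeroAtTwo → AdditiveRankZeroAtTwo →
    KolyvaginExactAtTwo → KolyvaginExactAtTwoShifted →
    Gamma1DoorIndexLawCTAtTwo → SigmaAccumulationModTwoAtTwo → StringentPrimitivityModTwoDeepWith RegularOnFullImageAtTwo →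
    ShiftedKolyvaginStructureModTwoDeepWithOnPos RegularOnFullImageAtTwo OnDeltaPlusCell →
    ShiftedKolyvaginStructureModTwoDeepWithOn (fun _ _ => True) OffFullImageCell → TwoTorsionHalf →
    RankOneAtTwoOffBigImageOddLocal :=
  fun hprint hO hM hSS hA h0 hS hG hK1 hK2 hK3p hK3γ hβ W _ _ hCM _hoff hr =>
    bsdp_two_rankOne_of_line_deep hprint hO hM hSS hA h0 hS hG hK1 hK2 hK3p hK3γ hβ W hCM hr

/-- **The «off the slice» binder is IDLE in the deep currency too**: the same thirteen statements give the PARENT `RankOneAtTwo`.  CONDITIONAL, closes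
nothing.  BSD is NOT proved by this. [cite: McCallumLMS1991, §5 Thm. 5.4] -/
theorem rankOneAtTwo_of_line_deep : S_print →
    GoodOrdinaryRankZeroAtTwo → MultiplicativeRankZeroAtTwo → SupersingularRankZeroAtTwo → AdditiveRankZeroAtTwo →
    KolyvaginExactAtTwo → KolyvaginExactAtTwoShifted →
    Gamma1DoorIndexLawCTAtTwo → SigmaAccumulationModTwoAtTwo → StringentPrimitivityModTwoDeepWith RegularOnFullImageAtTwo →
    ShiftedKolyvaginStructureModTwoDeepWithOnPos RegularOnFullImageAtTwo OnDeltaPlusCell →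
    ShiftedKolyvaginStructureModTwoDeepWithOn (fun _ _ => True) OffFullImageCell → TwoTorsionHalf →
    RankOneAtTwo :=
  fun hprint hO hM hSS hA h0 hS hG hK1 hK2 hK3p hK3γ hβ W _ _ hCM hr =>
    bsdp_two_rankOne_of_line_deep hprint hO hM hSS hA h0 hS hG hK1 hK2 hK3p hK3γ hβ W hCM hr

end Summit.BirchSwinnertonDyer.BirchSwinnertonDyer.Theorems.OffBigImageOddLocalAtTwo

end
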